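import Literature.AlgebraicGeometry.Frobenioids.Cor411iiAssemblyFSM
import Literature.AlgebraicGeometry.Frobenioids.Thm42OfPreStepsGeneral
import Literature.AlgebraicGeometry.Frobenioids.EquivalenceThm34iiiOfPreSteps
import Literature.AlgebraicGeometry.Frobenioids.BaseSectionsOfObjectsCor57FSMFF2024
import HarnessLib

/-!
# Frobenioids I, Corollary 4.11 (ii) AS TYPED from "`Ψ`, `Ψ⁻¹` preserve pre-steps and group-like objects"
# (the conclusion of Theorem 3.4 (ii)) — I: the reduction to the perfections of the isotropic parts, with
# no hypothesis on the base categories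

Mochizuki, *The geometry of Frobenioids I: the general theory*, Kyushu J. Math. **62** (2008)
293–400, Cor. 4.11 (ii) p. 91, proof pp. 92–94 [cite: MochizukiFrdI2008, Cor. 4.11 (ii) p.91]; the author's
*Comments* (Jan. 2024), item (28) (the revised condition (b) of "FSMFF-type", under which the printed route
to Thm. 3.4 (ii) through Prop. 1.14 (iii) goes through).

PROOF-ONLY file (seat abc-iut-L1-d6, cell sub-DAG S2 `plan/L1/SUBDAG-FrdI-Cor411.md`, node FrdI:Cor4.11(ii);
GAP row G-L1d8-1 "FSMFF ∖ FSM"). The base categories `D_i` enter the proof of Cor. 4.11 (ii) ONLY through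
Thm. 3.4 (ii) ("`Ψ` preserves pre-steps … and group-like objects"); everything downstream is base-free in the
tree — Thm. 3.4 (iii) (`FrdI.OfPreSteps.thm34iii_ofFunctor`, `FrdI.isFrobeniusCompatible_of_preservesPreSteps`,
seat abc-iut-L1-t11 lineage), Thm. 3.4 (v) (`cor411ii_inst_of_isSlim_of_thm34iii`, seat abc-iut-w4-d086
lineage), the setting of the proof of Thm. 4.2 at the perfections (`FrdI.T42.setting_perfection_asPrinted`,
seat abc-iut-w4-d105) and this seat's apex / descent (`cor411ii_of_congr_istr_pf`). This file:
* `cor411ii_of_preservesPreSteps_of_not_isOfGroupLikeType` / `cor411ii_of_preservesPreSteps` — the twin of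
  `cor411ii_of_isOfFSMType` (`Cor411iiAssemblyFSM`: the typed Cor. 4.11 (ii) modulo "the perfections
  `(C_i^istr)^pf` and their birationalizations are Frobenioids") with the FSM-type hypothesis REPLACED by the
  conclusion of Thm. 3.4 (ii) for `Ψ` and `Ψ⁻¹` (`PreservesMor … IsPreStep`; in the general version also
  `PreservesObj … IsGroupLikeObj` for the printed case split, `FrdI.OfPreSteps.groupLike_dichotomy`).
No new definitions; nothing of the paper is restated; nothing here is specific to the abc programme.
-/

namespace Literature.AlgebraicGeometry.Frobenioids

open CategoryTheory Opposite

universe w v v' u u'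

namespace PreFrobenioid

section Two

variable {D₁ : Type u} [Category.{v} D₁] {Φ₁ : D₁ᵒᵖ ⥤ CommMonCat.{w}}
  {C₁ : Type u'} [Category.{v'} C₁] {F₁ : C₁ ⥤ ElemFrobenioid Φ₁}
  {D₂ : Type u} [Category.{v} D₂] {Φ₂ : D₂ᵒᵖ ⥤ CommMonCat.{w}}
  {C₂ : Type u'} [Category.{v'} C₂] {F₂ : C₂ ⥤ ElemFrobenioid Φ₂}

set_option backward.isDefEq.respectTransparency false in
/-- **[FrdI] Cor. 4.11 (ii) AS TYPED, NOT of group-like type, from "`Ψ`, `Ψ⁻¹` preserve pre-steps"**, modulo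
"the perfections `(C_i^istr)^pf` and their birationalizations are Frobenioids" (`hPf_i`, `hB_i`): the
non-group-like case of the proof of Cor. 4.11 (ii) (restriction to `C_i^istr`, passage to `(C_i^istr)^pf`,
apex of the birational tower, descent), in which the bases enter only through the conclusion
"`Ψ`, `Ψ⁻¹` preserve pre-steps" of Thm. 3.4 (ii) (`h₁₂`, `h₂₁`): Thm. 3.4 (iii) for `Ψ^istr` by
`FrdI.isFrobeniusCompatible_of_preservesPreSteps`, the setting at the perfections by
`FrdI.T42.setting_perfection_asPrinted`. [cite: MochizukiFrdI2008, Cor. 4.11 (ii) p.91] -/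
theorem cor411ii_of_preservesPreSteps_of_not_isOfGroupLikeType (hF₁ : IsFrobenioid F₁) (hF₂ : IsFrobenioid F₂)
    (Ψ : C₁ ≌ C₂)
    (hpf₁ : Objectwise (fun M _ => IsPerfFactorial M) Φ₁) (hpf₂ : Objectwise (fun M _ => IsPerfFactorial M) Φ₂)
    (h₁₂ : PreFrobenioidData.PreservesMor Ψ.functor (PreFrobenioidData.ofFunctor Φ₁ F₁).IsPreStep
      (PreFrobenioidData.ofFunctor Φ₂ F₂).IsPreStep)
    (h₂₁ : PreFrobenioidData.PreservesMor Ψ.inverse (PreFrobenioidData.ofFunctor Φ₂ F₂).IsPreStep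
      (PreFrobenioidData.ofFunctor Φ₁ F₁).IsPreStep)
    (hG₁ : ¬ (PreFrobenioidData.ofFunctor Φ₁ F₁).IsOfGroupLikeType)
    (hG₂ : ¬ (PreFrobenioidData.ofFunctor Φ₂ F₂).IsOfGroupLikeType)
    (hPf₁ : IsFrobenioid (Perfection.ops (isFrobenioid_istr hF₁)).toFunctor)
    (hPf₂ : IsFrobenioid (Perfection.ops (isFrobenioid_istr hF₂)).toFunctor)
    (hB₁ : IsFrobenioid (Birat.toElemZero hPf₁ (hasBiratSquares_of_isFrobenioid hPf₁)))
    (hB₂ : IsFrobenioid (Birat.toElemZero hPf₂ (hasBiratSquares_of_isFrobenioid hPf₂))) :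
    (PreFrobenioidData.ofFunctor Φ₁ F₁).Cor411ii (PreFrobenioidData.ofFunctor Φ₂ F₂) Ψ := by
  classical
  intro hs
  have hq₁ := hs.standard.1.quasiIsotropic
  have hq₂ := hs.standard.2.quasiIsotropic
  obtain ⟨N₁, hN₁⟩ : ∃ A : C₁, ¬ IsGroupLikeObj F₁ A := by
    by_contra h
    exact hG₁ ⟨fun A => (PreFrobenioidData.ofFunctor_isGroupLikeObj F₁ A).2 (not_exists_not.mp h A)⟩
  obtain ⟨N₂, hN₂⟩ : ∃ A : C₂, ¬ IsGroupLikeObj F₂ A := by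
    by_contra h
    exact hG₂ ⟨fun A => (PreFrobenioidData.ofFunctor_isGroupLikeObj F₂ A).2 (not_exists_not.mp h A)⟩
  -- the isotropic parts `C_i^istr` (Frobenioids of isotropic, standard, non-group-like type; same `Φ_i`, `D_i`)
  haveI : (isotropicObjects F₂).IsClosedUnderIsomorphisms :=
    ⟨fun e h => IsIsotropic.of_iso hF₂.isPreFrobenioid e.symm h⟩
  let Ψi := Ψ.congrFullSubcategory (FrdI.isotropicObjects_inverseImage hF₁ hq₁ hq₂ Ψ)
  have hI₁ := isFrobenioid_istr hF₁
  have hI₂ := isFrobenioid_istr hF₂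
  have hiI₁ : (PreFrobenioidData.ofFunctor Φ₁ (istrFunctor F₁)).IsOfIsotropicType :=
    (PreFrobenioidData.ofFunctor_isOfIsotropicType _).mpr isOfIsotropicType_istr
  have hiI₂ : (PreFrobenioidData.ofFunctor Φ₂ (istrFunctor F₂)).IsOfIsotropicType :=
    (PreFrobenioidData.ofFunctor_isOfIsotropicType _).mpr isOfIsotropicType_istr
  have hqI₁ : (PreFrobenioidData.ofFunctor Φ₁ (istrFunctor F₁)).IsOfQuasiIsotropicType :=
    isOfQuasiIsotropicType_of_isOfIsotropicType Φ₁ (istrFunctor F₁) hI₁ hiI₁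
  have hqI₂ : (PreFrobenioidData.ofFunctor Φ₂ (istrFunctor F₂)).IsOfQuasiIsotropicType :=
    isOfQuasiIsotropicType_of_isOfIsotropicType Φ₂ (istrFunctor F₂) hI₂ hiI₂
  have hndI₁ : (PreFrobenioidData.ofFunctor Φ₁ (istrFunctor F₁)).IsNonDilatingOn :=
    ⟨hs.standard.1.nonDilating.nonDilating⟩
  have hndI₂ : (PreFrobenioidData.ofFunctor Φ₂ (istrFunctor F₂)).IsNonDilatingOn :=
    ⟨hs.standard.2.nonDilating.nonDilating⟩
  have hSI₁ := isOfStandardType_istr hF₁ hs.standard.1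
  have hSI₂ := isOfStandardType_istr hF₂ hs.standard.2
  have hGI₁ : ¬ (PreFrobenioidData.ofFunctor Φ₁ (istrFunctor F₁)).IsOfGroupLikeType := fun h =>
    hG₁ (isOfGroupLikeType_of_istr' hF₁ h)
  have hGI₂ : ¬ (PreFrobenioidData.ofFunctor Φ₂ (istrFunctor F₂)).IsOfGroupLikeType := fun h =>
    hG₂ (isOfGroupLikeType_of_istr' hF₂ h)
  have hT : PreFrobenioidData.Thm42Setting (PreFrobenioidData.ofFunctor Φ₁ (istrFunctor F₁))
      (PreFrobenioidData.ofFunctor Φ₂ (istrFunctor F₂)) := ⟨⟨hSI₁, hSI₂⟩, ⟨hiI₁, hiI₂⟩, ⟨hGI₁, hGI₂⟩⟩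
  -- non-group-like objects of the `C_i^istr`: the isotropic hulls of `N_i` (the hull is a base-isomorphism)
  have hNI₁ : ¬ IsGroupLikeObj (istrFunctor F₁) ((isotropification hF₁).obj N₁) := fun h =>
    hN₁ (isGroupLikeObj_of_isBaseIso (hullHom hF₁ N₁) (isIsotropicHull_hullHom hF₁ N₁).2.1.2 h)
  have hNI₂ : ¬ IsGroupLikeObj (istrFunctor F₂) ((isotropification hF₂).obj N₂) := fun h =>
    hN₂ (isGroupLikeObj_of_isBaseIso (hullHom hF₂ N₂) (isIsotropicHull_hullHom hF₂ N₂).2.1.2 h)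
  -- pre-steps of `C_i^istr` are pre-steps of `C_i` between isotropic objects: `Ψ^istr`, `(Ψ^istr)⁻¹` preserve them
  have h₁₂i : PreFrobenioidData.PreservesMor Ψi.functor (PreFrobenioidData.ofFunctor Φ₁ (istrFunctor F₁)).IsPreStep
      (PreFrobenioidData.ofFunctor Φ₂ (istrFunctor F₂)).IsPreStep := fun X Y φ hφ => h₁₂ φ.hom hφ
  have h₂₁i : PreFrobenioidData.PreservesMor Ψi.inverse (PreFrobenioidData.ofFunctor Φ₂ (istrFunctor F₂)).IsPreStep
      (PreFrobenioidData.ofFunctor Φ₁ (istrFunctor F₁)).IsPreStep := fun X Y φ hφ => h₂₁ φ.hom hφ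
  -- Thm. 3.4 (iii): `Ψ^istr` is compatible with arrows of Frobenius type
  have hΨi : IsFrobeniusCompatible (istrFunctor F₁) (istrFunctor F₂) Ψi.functor :=
    FrdI.isFrobeniusCompatible_of_preservesPreSteps hI₁ hI₂ hqI₁ hqI₂ hndI₁ hndI₂ Ψi h₁₂i h₂₁i
      ⟨_, hNI₁⟩ ⟨_, hNI₂⟩
  -- the setting of the proof of Thm. 4.2 for `(Ψ^istr)^pf`, from the printed hypotheses on the `C_i^istr`
  have S := FrdI.T42.setting_perfection_asPrinted Ψi hI₁ hI₂ hpf₁ hpf₂ hT hΨi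
  haveI := Perfection.map_isEquivalence (hF₁ := hI₁) (hF₂ := hI₂) Ψi hΨi
  exact cor411ii_of_congr_istr_pf hF₁ hF₂ Ψ hs hΨi
    (Perfection.map (hF₁ := hI₁) (hF₂ := hI₂) hΨi).asEquivalence rfl S _ _ hB₁ hB₂
    (fun _ _ φ hφ => S.isPrimaryPreStep_map hφ) (fun _ _ φ hφ => S.symm.isPrimaryPreStep_map hφ) hs

/-- **[FrdI] Cor. 4.11 (ii) AS TYPED from "`Ψ`, `Ψ⁻¹` preserve pre-steps and group-like objects"** (the
conclusion of Thm. 3.4 (ii)), modulo "the perfections `(C_i^istr)^pf` and their birationalizations are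
Frobenioids" — the twin of `cor411ii_of_isOfFSMType` with NO hypothesis on the bases: printed case split
(`FrdI.OfPreSteps.groupLike_dichotomy`); group-like type ⇒ Div-slim = slim and the slim case is Thm. 3.4 (v)
from Thm. 3.4 (iii) (`FrdI.OfPreSteps.thm34iii_ofFunctor`, `cor411ii_inst_of_isSlim_of_thm34iii`); else
`cor411ii_of_preservesPreSteps_of_not_isOfGroupLikeType`. [cite: MochizukiFrdI2008, Cor. 4.11 (ii) p.91] -/
theorem cor411ii_of_preservesPreSteps (hF₁ : IsFrobenioid F₁) (hF₂ : IsFrobenioid F₂) (Ψ : C₁ ≌ C₂)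
    (hpf₁ : Objectwise (fun M _ => IsPerfFactorial M) Φ₁) (hpf₂ : Objectwise (fun M _ => IsPerfFactorial M) Φ₂)
    (h₁₂ : PreFrobenioidData.PreservesMor Ψ.functor (PreFrobenioidData.ofFunctor Φ₁ F₁).IsPreStep
      (PreFrobenioidData.ofFunctor Φ₂ F₂).IsPreStep)
    (h₂₁ : PreFrobenioidData.PreservesMor Ψ.inverse (PreFrobenioidData.ofFunctor Φ₂ F₂).IsPreStep
      (PreFrobenioidData.ofFunctor Φ₁ F₁).IsPreStep)
    (hG : PreFrobenioidData.PreservesObj Ψ.functor (PreFrobenioidData.ofFunctor Φ₁ F₁).IsGroupLikeObj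
      (PreFrobenioidData.ofFunctor Φ₂ F₂).IsGroupLikeObj)
    (hG' : PreFrobenioidData.PreservesObj Ψ.inverse (PreFrobenioidData.ofFunctor Φ₂ F₂).IsGroupLikeObj
      (PreFrobenioidData.ofFunctor Φ₁ F₁).IsGroupLikeObj)
    (hPf₁ : IsFrobenioid (Perfection.ops (isFrobenioid_istr hF₁)).toFunctor)
    (hPf₂ : IsFrobenioid (Perfection.ops (isFrobenioid_istr hF₂)).toFunctor)
    (hB₁ : IsFrobenioid (Birat.toElemZero hPf₁ (hasBiratSquares_of_isFrobenioid hPf₁)))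
    (hB₂ : IsFrobenioid (Birat.toElemZero hPf₂ (hasBiratSquares_of_isFrobenioid hPf₂))) :
    (PreFrobenioidData.ofFunctor Φ₁ F₁).Cor411ii (PreFrobenioidData.ofFunctor Φ₂ F₂) Ψ := by
  intro hs
  rcases FrdI.OfPreSteps.groupLike_dichotomy Ψ hG hG' with ⟨hg₁, hg₂⟩ | ⟨⟨N₁, hN₁⟩, ⟨N₂, hN₂⟩⟩
  · -- group-like type: "Div-slimness amounts to slimness", and the slim case is Thm. 3.4 (v)
    have hsl₁ : IsSlim D₁ := PreFrobenioidData.isSlim_of_isDivSlim_of_isOfGroupLikeType _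
      (exists_base_iso_of_isFrobenioid F₁ hF₁) hg₁ hs.divSlim.1
    have hsl₂ : IsSlim D₂ := PreFrobenioidData.isSlim_of_isDivSlim_of_isOfGroupLikeType _
      (exists_base_iso_of_isFrobenioid F₂ hF₂) hg₂ hs.divSlim.2
    exact cor411ii_inst_of_isSlim_of_thm34iii F₁ F₂ Ψ hF₁ hF₂ hsl₁ hsl₂
      (FrdI.OfPreSteps.thm34iii_ofFunctor hF₁ hF₂ Ψ h₁₂ h₂₁ hG hG')
      (FrdI.OfPreSteps.thm34iii_ofFunctor hF₂ hF₁ Ψ.symm h₂₁ h₁₂ hG' hG) hs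
  · exact cor411ii_of_preservesPreSteps_of_not_isOfGroupLikeType hF₁ hF₂ Ψ hpf₁ hpf₂ h₁₂ h₂₁
      (fun h => hN₁ (h.obj N₁)) (fun h => hN₂ (h.obj N₂)) hPf₁ hPf₂ hB₁ hB₂ hs

end Two

end PreFrobenioid

end Literature.AlgebraicGeometry.Frobenioids
-- enqueue re-land 2026-08-26T08:46:55Z (abc-iut-L1-d6 g3): comment-only, declarations byte-identical to p427221; purpose = re-dispatch the stranded olean build
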